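import Literature.RingTheory.HopfAlgebra.SquareZeroPointsConvolution
import HarnessLib

/-!
# Descent of square-zero lifts of Hopf-algebra points along an abstract kernel pair («the lifts form a torsor under the coordinate module;
# an exact coefficient complex makes the local lift descend») — the cosimplicial core

Topic `Literature/RingTheory/HopfAlgebra`, namespace `Literature.RingTheory.HopfAlgebra`.  THEOREMS ONLY; no definition, no named fact, no
instance, no notation, no `sorry`.  Sequel of ★ `SquareZeroPointsConvolution` (organ 1: convolution near the counit is addition; coordinates of
`I`-valued points of a linearly-unobstructed nilpotent algebra).

THE PRINT ([SGA1] Exp. III §5 (torsor of liftings under `Hom(Ω, 𝒥)`) with Exp. VIII §1 (faithfully flat descent); [Tate1967] §2.2 ∕ §2.4 for the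
formal group; [Katz1981SerreTate] §1.1 for the `p`-divisible group): to lift a point of a group scheme `G = Spec E` along a square-zero thickening it
suffices to lift it LOCALLY for a covering whose Čech complex with coefficients in the coordinate module of the formal group is exact in degree
one — the two pull-backs of a local lift differ by a point of the formal group `Ĝ = Spf 𝒪(G⁰)` with coordinates in the square-zero ideal, these
coordinates form a `1`-COCYCLE (the group law is ADDITION there, ★ organ 1), a cocycle is a coboundary, and correcting the local lift by the
coboundary makes the two pull-backs AGREE.  This file is the RING form with an ABSTRACT cosimplicial target (`D ⇉ D₂ ⇶ D₃`, square-zero ideals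
`I₁, I₂, I₃`, the degree-one exactness an HYPOTHESIS `hH1`); the sequel instantiates `D₂ = D ⊗_{A′} D`, `D₃ = D ⊗ (D ⊗ D)` for a faithfully flat
`A′ → D` (★ `Flat/AmitsurKernelPair`, Mathlib `Algebra.IsEffective.of_faithfullyFlat`).

DATA.  `E` a commutative Hopf `A`-algebra (points `E →ₐ[A] D` = Mathlib's convolution GROUP `WithConv (E →ₐ[A] D)`, functorial in `D`);
`r : E →ₐc[A] E₀` a SURJECTIVE bialgebra map onto a bialgebra `E₀` («the unit component») whose kernel is generated by an IDEMPOTENT (`Spec E₀ ↪ Spec E`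
open and closed through the unit), with coordinates `x : σ → E₀` as in organ 1 (`hgen`, `hlin`, `hε`).
* §1 points: `comp_ofConv_convMul` (functoriality of Mathlib's convolution product in the target), `toConv_comp_antipode_mul_self` ∕
  `toConv_mul_toConv_comp_antipode` ∕ `ofConv_one_comp_antipode` (the antipode inverts points, for ANY commutative target), `sub_algebraMap_counit_mem_of_forall_sub_mem`
  (the RATIO of two points congruent mod `I` reduces to the unit), `exists_comp_eq_of_forall_sub_algebraMap_counit_mem` (a point reducing to the unit FACTORS
  THROUGH the unit component: the idempotent goes to an idempotent of `I`, hence to `0`), `apply_mem_of_comp_eq` (its coordinates lie in `I`).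
* §2 **`exists_point_comp_eq_comp_of_cocycle_exact`** — the CORE: cofaces `i₁ i₂ : D → D₂`, `q₁₂ q₂₃ q₁₃ : D₂ → D₃` with the simplicial identities,
  square-zero ideals `I₁ ↦ I₂ ↦ I₃`, the degree-one exactness hypothesis `hH1` for `σ`-tuples of coordinates, and a point `y : E →ₐ[A] D` whose two
  images in `D₂` agree modulo `I₂` ⇒ there is a point `y′ ≡ y (mod I₁)` with `i₁ ∘ y′ = i₂ ∘ y′`.
Written for cell `hodgecm-mathlib` (P6b σ2, E2a road KF1♭, organ T3 step S8); HC_CM is proved only modulo the 7 printed citations until rung 0 closes;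
nothing here is about HC.

## References
* [SGA1] A. Grothendieck, *SGA 1*, Exp. III §5 (Prop. 5.1: liftings form a torsor), Exp. VIII §1 (faithfully flat descent).
* [Tate1967] J. T. Tate, *p-divisible groups* (1967), §2.2, §2.4.
* [Katz1981SerreTate] N. Katz, *Serre–Tate local moduli*, LNM 868 (1981), §1.1.
-/

universe u v v' w uσ

open TensorProduct WithConv

namespace Literature.RingTheory.HopfAlgebra

/-! ## §1 Points of a commutative Hopf algebra near the counit -/

section Points

variable {A : Type u} [CommRing A] {E : Type v} [CommRing E] [HopfAlgebra A E]
variable {D : Type w} [CommRing D] [Algebra A D] {D' : Type w} [CommRing D'] [Algebra A D']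

/-- Functoriality of the convolution product in the TARGET (Mathlib `AlgHom.comp_convMul_distrib`, pointwise): for an algebra map `π : D → D′`,
`π ((f * g) e) = ((π ∘ f) * (π ∘ g)) e`. [cite: Waterhouse1979, §1.4] -/
theorem comp_ofConv_convMul (π : D →ₐ[A] D') (f g : WithConv (E →ₐ[A] D)) (e : E) :
    π ((f * g).ofConv e) = (toConv (π.comp f.ofConv) * toConv (π.comp g.ofConv)).ofConv e := by
  have h := AlgHom.comp_convMul_distrib π f g
  exact (congrArg (fun φ : E →ₐ[A] D' => φ e) h :)

/-- **The antipode inverts points (left)**: for a commutative Hopf algebra `E` and ANY commutative `A`-algebra `D`, `(f ∘ S) * f = 1` in Mathlib's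
convolution monoid `WithConv (E →ₐ[A] D)` (Mathlib's `AlgHom.convGroup` asks a bialgebra structure on the target; this is its proof for a bare
commutative target). [cite: Waterhouse1979, §1.4] -/
theorem toConv_comp_antipode_mul_self (f : E →ₐ[A] D) :
    toConv (f.comp (HopfAlgebra.antipodeAlgHom A E)) * toConv f = 1 := by
  have H : (Algebra.TensorProduct.lmul' A (S := D)).comp (Algebra.TensorProduct.map f f) =
      f.comp (Algebra.TensorProduct.lmul' A) := by ext <;> simp
  trans toConv <| ((Algebra.TensorProduct.lmul' A (S := D)).comp (Algebra.TensorProduct.map f f)).comp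
    ((Algebra.TensorProduct.map (HopfAlgebra.antipodeAlgHom A E) (.id _ _)).comp (Bialgebra.comulAlgHom A E))
  · rw [AlgHom.convMul_def, AlgHom.comp_assoc, ← AlgHom.comp_assoc (Algebra.TensorProduct.map f f),
      ← Algebra.TensorProduct.map_comp, AlgHom.comp_id]
  rw [H, AlgHom.comp_assoc, WithConv.ext_iff, ← AlgHom.toLinearMap_injective.eq_iff]
  change f.toLinearMap.comp (toConv (HopfAlgebra.antipode A (A := E)) * toConv LinearMap.id).ofConv =
    WithConv.ofConv (1 : WithConv <| E →ₗ[A] D)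
  rw [LinearMap.antipode_mul_id]
  ext
  simp

/-- **The antipode inverts points (right)**: `f * (f ∘ S) = 1`. [cite: Waterhouse1979, §1.4] -/
theorem toConv_mul_toConv_comp_antipode (f : E →ₐ[A] D) :
    toConv f * toConv (f.comp (HopfAlgebra.antipodeAlgHom A E)) = 1 := by
  have H : (Algebra.TensorProduct.lmul' A (S := D)).comp (Algebra.TensorProduct.map f f) =
      f.comp (Algebra.TensorProduct.lmul' A) := by ext <;> simp
  trans toConv <| ((Algebra.TensorProduct.lmul' A (S := D)).comp (Algebra.TensorProduct.map f f)).comp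
    ((Algebra.TensorProduct.map (.id _ _) (HopfAlgebra.antipodeAlgHom A E)).comp (Bialgebra.comulAlgHom A E))
  · rw [AlgHom.convMul_def, AlgHom.comp_assoc, ← AlgHom.comp_assoc (Algebra.TensorProduct.map f f),
      ← Algebra.TensorProduct.map_comp, AlgHom.comp_id]
  rw [H, AlgHom.comp_assoc, WithConv.ext_iff, ← AlgHom.toLinearMap_injective.eq_iff]
  change f.toLinearMap.comp (toConv LinearMap.id * toConv (HopfAlgebra.antipode A (A := E))).ofConv =
    WithConv.ofConv (1 : WithConv <| E →ₗ[A] D)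
  rw [LinearMap.id_mul_antipode]
  ext
  simp

/-- The unit point is fixed by the antipode: `1 ∘ S = 1` (`counit ∘ S = counit`). [cite: Waterhouse1979, §1.4] -/
theorem ofConv_one_comp_antipode :
    (WithConv.ofConv (1 : WithConv (E →ₐ[A] D))).comp (HopfAlgebra.antipodeAlgHom A E) =
      WithConv.ofConv (1 : WithConv (E →ₐ[A] D)) := by
  rw [AlgHom.convOne_def, ofConv_toConv, AlgHom.comp_assoc, AlgHom.counitAlgHom_comp_antipodeAlgHom]

/-- Reduction modulo an ideal is a homomorphism on points, read on ONE consequence: if two points `ψ₁, ψ₂ : E →ₐ[A] D` agree modulo `I`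
(`ψ₁ e − ψ₂ e ∈ I`), their RATIO `ψ₁ * (ψ₂ ∘ S)` reduces to the unit: `(ψ₁ * (ψ₂ ∘ S)) e − algebraMap (counit e) ∈ I`.
[cite: Waterhouse1979, §12.2] -/
theorem sub_algebraMap_counit_mem_of_forall_sub_mem (I : Ideal D) (ψ₁ ψ₂ : E →ₐ[A] D) (h : ∀ e, ψ₁ e - ψ₂ e ∈ I) (e : E) :
    (toConv ψ₁ * toConv (ψ₂.comp (HopfAlgebra.antipodeAlgHom A E))).ofConv e - algebraMap A D (Coalgebra.counit e) ∈ I := by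
  let π : D →ₐ[A] D ⧸ I := Ideal.Quotient.mkₐ A I
  have hπ : π.comp ψ₁ = π.comp ψ₂ := AlgHom.ext fun e => (Ideal.Quotient.eq).mpr (h e)
  rw [← Ideal.Quotient.eq, ← Ideal.Quotient.mkₐ_eq_mk A]
  change π ((toConv ψ₁ * toConv (ψ₂.comp (HopfAlgebra.antipodeAlgHom A E))).ofConv e) = π (algebraMap A D (Coalgebra.counit e))
  rw [comp_ofConv_convMul, AlgHom.commutes]
  change (toConv (π.comp ψ₁) * toConv ((π.comp ψ₂).comp (HopfAlgebra.antipodeAlgHom A E))).ofConv e = _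
  rw [hπ, toConv_mul_toConv_comp_antipode]
  rfl

variable {E₀ : Type v'} [CommRing E₀] [Bialgebra A E₀] (r : E →ₐc[A] E₀)

/-- **A point reducing to the unit FACTORS THROUGH THE UNIT COMPONENT.**  If `r : E ↠ E₀` is a surjective bialgebra map whose kernel is generated by
an idempotent `e₁` (`Spec E₀ ↪ Spec E` open and closed; `counit e₁ = counit₀ (r e₁) = 0`), then every point `ψ : E →ₐ[A] D` with
`ψ e − algebraMap (counit e) ∈ I`, `I · I = 0`, kills `e₁` (`ψ e₁` is an idempotent lying in `I`) and so factors as `ψ₀ ∘ r`.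
[cite: Tate1967, §2.4] -/
theorem exists_comp_eq_of_forall_sub_algebraMap_counit_mem (hr : Function.Surjective r) (e₁ : E) (he₁ : IsIdempotentElem e₁)
    (hker : RingHom.ker (r : E →ₐ[A] E₀) = Ideal.span {e₁}) (I : Ideal D) (hI : I * I = ⊥) (ψ : E →ₐ[A] D)
    (hψ : ∀ e, ψ e - algebraMap A D (Coalgebra.counit e) ∈ I) : ∃ ψ₀ : E₀ →ₐ[A] D, ψ₀.comp (r : E →ₐ[A] E₀) = ψ := by
  have hre₁ : r e₁ = 0 := by
    have : e₁ ∈ RingHom.ker (r : E →ₐ[A] E₀) := by rw [hker]; exact Ideal.mem_span_singleton_self e₁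
    simpa using this
  have hce₁ : Coalgebra.counit (R := A) e₁ = 0 := by
    rw [← CoalgHomClass.counit_comp_apply r e₁, hre₁, map_zero]
  have hψe₁I : ψ e₁ ∈ I := by simpa [hce₁] using hψ e₁
  have hψe₁ : ψ e₁ = 0 := by
    have hmem : ψ e₁ * ψ e₁ ∈ I * I := Ideal.mul_mem_mul hψe₁I hψe₁I
    rw [hI, ← map_mul, he₁.eq] at hmem
    exact (Submodule.mem_bot D).mp hmem
  have hle : RingHom.ker (r : E →ₐ[A] E₀) ≤ RingHom.ker ψ := by
    rw [hker, Ideal.span_le, Set.singleton_subset_iff]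
    exact hψe₁
  exact ⟨AlgHom.liftOfSurjective (r : E →ₐ[A] E₀) hr ψ hle, AlgHom.liftOfSurjective_comp _ hr ψ hle⟩

/-- The coordinates of the factorisation lie in `I`: if `ψ = ψ₀ ∘ r` reduces to the unit modulo `I` and the coordinate functions `x_s ∈ E₀` are killed
by the counit, then `ψ₀ (x s) ∈ I`. [cite: Tate1967, §2.4] -/
theorem apply_mem_of_comp_eq (hr : Function.Surjective r) {σ : Type uσ} (x : σ → E₀) (hε : ∀ s, Coalgebra.counit (R := A) (x s) = 0)
    (I : Ideal D) (ψ : E →ₐ[A] D) (hψ : ∀ e, ψ e - algebraMap A D (Coalgebra.counit e) ∈ I) (ψ₀ : E₀ →ₐ[A] D)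
    (hψ₀ : ψ₀.comp (r : E →ₐ[A] E₀) = ψ) (s : σ) : ψ₀ (x s) ∈ I := by
  obtain ⟨z, hz⟩ := hr (x s)
  have hcz : Coalgebra.counit (R := A) z = 0 := by rw [← CoalgHomClass.counit_comp_apply r z, hz, hε]
  have h := hψ z
  rw [← hψ₀, AlgHom.comp_apply, hcz, map_zero, sub_zero] at h
  change ψ₀ (r z) ∈ I at h
  rwa [hz] at h

end Points

/-! ## §2 The cosimplicial core: correcting a local lift by a coboundary -/

section Core

variable {A : Type u} [CommRing A] {E : Type v} [CommRing E] [HopfAlgebra A E]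
variable {E₀ : Type v'} [CommRing E₀] [Bialgebra A E₀] (r : E →ₐc[A] E₀)
variable {σ : Type uσ} (x : σ → E₀)
variable {D : Type w} [CommRing D] [Algebra A D] {D₂ : Type w} [CommRing D₂] [Algebra A D₂] {D₃ : Type w} [CommRing D₃] [Algebra A D₃]

/-- **THE COSIMPLICIAL CORE OF THE DESCENT OF SQUARE-ZERO LIFTS** ([SGA1] III §5 + VIII §1; [Tate1967] §2.4; [Katz1981SerreTate] §1.1).
DATA: `E` a commutative Hopf `A`-algebra; `r : E ↠ E₀` a surjective bialgebra map with kernel generated by an idempotent `e₁` (the unit component),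
coordinates `x : σ → E₀` GENERATING `E₀` with LINEARLY-UNOBSTRUCTED relations and killed by the counit (★ organ 1); a cosimplicial target
`i₁ i₂ : D → D₂`, `q₁₂ q₂₃ q₁₃ : D₂ → D₃` with the three identities `q₁₂ ∘ i₂ = q₂₃ ∘ i₁`, `q₁₂ ∘ i₁ = q₁₃ ∘ i₁`, `q₂₃ ∘ i₂ = q₁₃ ∘ i₂`; square-zero ideals
`I₁ ⊆ D`, `I₂ ⊆ D₂`, `I₃ ⊆ D₃` with `i₂ I₁ ⊆ I₂`, `q₁₂ I₂ ⊆ I₃`, `q₂₃ I₂ ⊆ I₃` (the other two compatibilities are not needed); EXACTNESS IN DEGREE ONE for coordinate tuples (`hH1`: a `σ`-tuple `c ∈ I₂^σ` with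
`q₁₂ c + q₂₃ c = q₁₃ c` is `i₁ b − i₂ b` for some `b ∈ I₁^σ`); and a point `y : E →ₐ[A] D` whose two images in `D₂` agree modulo `I₂`.
CONCLUSION: there is a point `y′ : E →ₐ[A] D` congruent to `y` modulo `I₁` whose two images AGREE: `i₁ ∘ y′ = i₂ ∘ y′`.
PROOF: `u := (i₁ ∘ y)(i₂ ∘ y)⁻¹` reduces to the unit mod `I₂`, so `u = u₀ ∘ r` with coordinates `c_s = u₀ (x s) ∈ I₂`; the group identity
`(q₁₂ u)(q₂₃ u) = q₁₃ u` in the points of `D₃` (simplicial identities) reads, by ADDITIVITY of coordinates (organ 1), `q₁₂ c + q₂₃ c = q₁₃ c`; `hH1` gives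
`b`; the point `β₀` of `E₀` with coordinates `b` exists (organ 1), `β := β₀ ∘ r`; then `u₀ * (i₂ β₀) = i₁ β₀` by comparing coordinates (organ 1 uniqueness),
whence `(i₁ y)(i₂ y)⁻¹ (i₂ β) = i₁ β` in the group of points and `y′ := β⁻¹ * y` has `i₁ ∘ y′ = (i₁ β)⁻¹ (i₁ y) = (i₂ β)⁻¹ (i₂ y) = i₂ ∘ y′`.
[cite: SGA1, Exp. III Prop. 5.1 and Exp. VIII Lemma 1.5] [cite: Tate1967, §2.4] [cite: Katz1981SerreTate, §1.1 (Lemmas 1.1.1–1.1.3)] -/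
theorem exists_point_comp_eq_comp_of_cocycle_exact
    (hr : Function.Surjective r) (e₁ : E) (he₁ : IsIdempotentElem e₁) (hker : RingHom.ker (r : E →ₐ[A] E₀) = Ideal.span {e₁})
    (hgen : Function.Surjective (MvPolynomial.aeval x : MvPolynomial σ A →ₐ[A] E₀))
    (hlin : ∀ P : MvPolynomial σ A, MvPolynomial.aeval x P = 0 →
      MvPolynomial.coeff 0 P = 0 ∧ ∀ s, MvPolynomial.coeff (Finsupp.single s 1) P = 0)
    (hε : ∀ s, Coalgebra.counit (R := A) (x s) = 0)
    (i₁ i₂ : D →ₐ[A] D₂) (q₁₂ q₂₃ q₁₃ : D₂ →ₐ[A] D₃)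
    (hq₁ : q₁₂.comp i₂ = q₂₃.comp i₁) (hq₂ : q₁₂.comp i₁ = q₁₃.comp i₁) (hq₃ : q₂₃.comp i₂ = q₁₃.comp i₂)
    (I₁ : Ideal D) (I₂ : Ideal D₂) (I₃ : Ideal D₃) (hI₁ : I₁ * I₁ = ⊥) (hI₂ : I₂ * I₂ = ⊥) (hI₃ : I₃ * I₃ = ⊥)
    (hi₂ : I₁.map i₂ ≤ I₂) (hq₁₂ : I₂.map q₁₂ ≤ I₃) (hq₂₃ : I₂.map q₂₃ ≤ I₃)
    (hH1 : ∀ c : σ → D₂, (∀ s, c s ∈ I₂) → (∀ s, q₁₂ (c s) + q₂₃ (c s) = q₁₃ (c s)) →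
      ∃ b : σ → D, (∀ s, b s ∈ I₁) ∧ ∀ s, i₁ (b s) - i₂ (b s) = c s)
    (y : E →ₐ[A] D) (hy : ∀ e, i₁ (y e) - i₂ (y e) ∈ I₂) :
    ∃ y' : E →ₐ[A] D, (∀ e, y' e - y e ∈ I₁) ∧ i₁.comp y' = i₂.comp y' := by
  classical
  -- notation: `S` the antipode; push-forward of points along an algebra map is multiplicative (Mathlib) and commutes with `∘ S`
  set S : E →ₐ[A] E := HopfAlgebra.antipodeAlgHom A E with hS
  have push_mul : ∀ {D' D'' : Type w} [CommRing D'] [Algebra A D'] [CommRing D''] [Algebra A D''] (π : D' →ₐ[A] D'')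
      (f g : WithConv (E →ₐ[A] D')), toConv (π.comp (f * g).ofConv) = toConv (π.comp f.ofConv) * toConv (π.comp g.ofConv) := by
    intro D' D'' _ _ _ _ π f g
    rw [AlgHom.comp_convMul_distrib]
  -- the ratio `u = ψ₁ * ψ₂^S` of the two images and its factorisation through the unit component
  set ψ₁ : E →ₐ[A] D₂ := i₁.comp y with hψ₁
  set ψ₂ : E →ₐ[A] D₂ := i₂.comp y with hψ₂
  set u : WithConv (E →ₐ[A] D₂) := toConv ψ₁ * toConv (ψ₂.comp S) with hu
  have hu_unit : ∀ e, u.ofConv e - algebraMap A D₂ (Coalgebra.counit e) ∈ I₂ :=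
    sub_algebraMap_counit_mem_of_forall_sub_mem I₂ ψ₁ ψ₂ hy
  obtain ⟨u₀, hu₀⟩ := exists_comp_eq_of_forall_sub_algebraMap_counit_mem r hr e₁ he₁ hker I₂ hI₂ u.ofConv hu_unit
  have hc : ∀ s, u₀ (x s) ∈ I₂ := apply_mem_of_comp_eq r hr x hε I₂ u.ofConv hu_unit u₀ hu₀
  -- the cocycle identity `(q₁₂ u)(q₂₃ u) = q₁₃ u` in the points of `D₃`
  have hcoc : toConv (q₁₂.comp u.ofConv) * toConv (q₂₃.comp u.ofConv) = toConv (q₁₃.comp u.ofConv) := by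
    have e12 : toConv (q₁₂.comp u.ofConv) = toConv ((q₁₂.comp i₁).comp y) * toConv (((q₁₂.comp i₂).comp y).comp S) := by
      rw [hu, push_mul]; rfl
    have e23 : toConv (q₂₃.comp u.ofConv) = toConv ((q₂₃.comp i₁).comp y) * toConv (((q₂₃.comp i₂).comp y).comp S) := by
      rw [hu, push_mul]; rfl
    have e13 : toConv (q₁₃.comp u.ofConv) = toConv ((q₁₃.comp i₁).comp y) * toConv (((q₁₃.comp i₂).comp y).comp S) := by
      rw [hu, push_mul]; rfl
    rw [e12, e23, e13, hq₁, hq₂, hq₃, mul_assoc, ← mul_assoc (toConv (((q₂₃.comp i₁).comp y).comp S)), hS,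
      toConv_comp_antipode_mul_self, one_mul]
  -- … read on the unit component `E₀` (cancel the surjection `r`)
  have hcoc₀ : (toConv (q₁₂.comp u₀) * toConv (q₂₃.comp u₀)).ofConv = q₁₃.comp u₀ := by
    have h1 : (toConv (q₁₂.comp u₀) * toConv (q₂₃.comp u₀)).ofConv.comp (r : E →ₐ[A] E₀) =
        (q₁₃.comp u₀).comp (r : E →ₐ[A] E₀) := by
      rw [AlgHom.convMul_comp_bialgHom_distrib, AlgHom.comp_assoc, AlgHom.comp_assoc, AlgHom.comp_assoc, hu₀,
        ← ofConv_toConv (q₁₃.comp u.ofConv), ← hcoc]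
    refine AlgHom.ext fun z => ?_
    obtain ⟨e, rfl⟩ := hr z
    exact congrArg (fun φ : E →ₐ[A] D₃ => φ e) h1
  -- … in coordinates: `q₁₂ c + q₂₃ c = q₁₃ c`
  have hcoord : ∀ s, q₁₂ (u₀ (x s)) + q₂₃ (u₀ (x s)) = q₁₃ (u₀ (x s)) := by
    intro s
    have h := convMul_apply_generator x hgen hε I₃ hI₃ (toConv (q₁₂.comp u₀)) (toConv (q₂₃.comp u₀))
      (fun s => hq₁₂ (Ideal.mem_map_of_mem _ (hc s))) (fun s => hq₂₃ (Ideal.mem_map_of_mem _ (hc s))) s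
    rw [hcoc₀] at h
    simpa using h.symm
  -- the coboundary `b` and the correcting point `β = β₀ ∘ r`
  obtain ⟨b, hbI, hb⟩ := hH1 (fun s => u₀ (x s)) hc hcoord
  obtain ⟨β₀, hβ₀⟩ := exists_algHom_apply_eq_of_sq_zero x hgen hlin I₁ hI₁ b hbI
  have hβ₀I : ∀ s, β₀ (x s) ∈ I₁ := fun s => (hβ₀ s).symm ▸ hbI s
  set β : E →ₐ[A] D := β₀.comp (r : E →ₐ[A] E₀) with hβ
  -- KEY: `u * (i₂ β) = i₁ β` in the points of `D₂`, by comparing coordinates on `E₀`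
  have hkey₀ : (toConv u₀ * toConv (i₂.comp β₀)).ofConv = i₁.comp β₀ := by
    refine algHom_ext_of_apply_eq x hgen fun s => ?_
    rw [convMul_apply_generator x hgen hε I₂ hI₂ (toConv u₀) (toConv (i₂.comp β₀)) hc
      (fun s => hi₂ (Ideal.mem_map_of_mem _ (hβ₀I s))) s]
    change u₀ (x s) + i₂ (β₀ (x s)) = i₁ (β₀ (x s))
    rw [hβ₀, ← hb s]
    abel
  have hkey : u * toConv (i₂.comp β) = toConv (i₁.comp β) := by
    apply WithConv.ext
    change (u * toConv (i₂.comp (β₀.comp (r : E →ₐ[A] E₀)))).ofConv = i₁.comp (β₀.comp (r : E →ₐ[A] E₀))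
    rw [← AlgHom.comp_assoc, ← AlgHom.comp_assoc, ← hkey₀, AlgHom.convMul_comp_bialgHom_distrib, hu₀]
  -- hence `ψ₁ = (i₁ β) (i₂ β)^S ψ₂`
  have hψ₁eq : toConv (i₁.comp β) * toConv ((i₂.comp β).comp S) * toConv ψ₂ = toConv ψ₁ := by
    calc toConv (i₁.comp β) * toConv ((i₂.comp β).comp S) * toConv ψ₂
        = u * toConv (i₂.comp β) * toConv ((i₂.comp β).comp S) * toConv ψ₂ := by rw [hkey]
      _ = u * (toConv (i₂.comp β) * toConv ((i₂.comp β).comp S)) * toConv ψ₂ := by rw [mul_assoc u]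
      _ = u * toConv ψ₂ := by rw [hS, toConv_mul_toConv_comp_antipode, mul_one]
      _ = toConv ψ₁ * (toConv (ψ₂.comp S) * toConv ψ₂) := by rw [hu, mul_assoc]
      _ = toConv ψ₁ := by rw [hS, toConv_comp_antipode_mul_self, mul_one]
  -- the corrected point `y′ := β^S * y`
  set Y' : WithConv (E →ₐ[A] D) := toConv (β.comp S) * toConv y with hY'
  -- `β` reduces to the unit point modulo `I₁`
  have hβunit : ∀ e, β e - algebraMap A D (Coalgebra.counit e) ∈ I₁ := by
    intro e
    have h := sub_algebraMap_counit_mem x hgen hε I₁ β₀ hβ₀I (r e)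
    rwa [CoalgHomClass.counit_comp_apply] at h
  refine ⟨Y'.ofConv, fun e => ?_, ?_⟩
  · -- `y′ ≡ y (mod I₁)`
    let π : D →ₐ[A] D ⧸ I₁ := Ideal.Quotient.mkₐ A I₁
    have hπβ : π.comp β = WithConv.ofConv (1 : WithConv (E →ₐ[A] D ⧸ I₁)) := by
      refine AlgHom.ext fun e => ?_
      change π (β e) = algebraMap A (D ⧸ I₁) (Coalgebra.counit e)
      rw [← (Ideal.Quotient.mkₐ A I₁).commutes, Ideal.Quotient.mkₐ_eq_mk]
      exact (Ideal.Quotient.eq).mpr (hβunit e)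
    have hπY' : toConv (π.comp Y'.ofConv) = toConv (π.comp y) := by
      rw [hY', push_mul, ← AlgHom.comp_assoc, hπβ, hS, ofConv_one_comp_antipode, toConv_ofConv, one_mul]
    rw [← Ideal.Quotient.eq, ← Ideal.Quotient.mkₐ_eq_mk A]
    exact congrArg (fun φ : WithConv (E →ₐ[A] D ⧸ I₁) => φ.ofConv e) hπY'
  · -- the two images of `y′` agree
    have h1 : toConv (i₁.comp Y'.ofConv) = toConv ((i₁.comp β).comp S) * toConv ψ₁ := by rw [hY', push_mul]; rfl
    have h2 : toConv (i₂.comp Y'.ofConv) = toConv ((i₂.comp β).comp S) * toConv ψ₂ := by rw [hY', push_mul]; rfl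
    have h3 : toConv ((i₁.comp β).comp S) * toConv ψ₁ = toConv ((i₂.comp β).comp S) * toConv ψ₂ := by
      calc toConv ((i₁.comp β).comp S) * toConv ψ₁
          = toConv ((i₁.comp β).comp S) * (toConv (i₁.comp β) * toConv ((i₂.comp β).comp S) * toConv ψ₂) := by rw [hψ₁eq]
        _ = (toConv ((i₁.comp β).comp S) * toConv (i₁.comp β)) * (toConv ((i₂.comp β).comp S) * toConv ψ₂) := by
            simp only [mul_assoc]
        _ = toConv ((i₂.comp β).comp S) * toConv ψ₂ := by rw [hS, toConv_comp_antipode_mul_self, one_mul]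
    have h4 : toConv (i₁.comp Y'.ofConv) = toConv (i₂.comp Y'.ofConv) := by rw [h1, h2, h3]
    exact congrArg WithConv.ofConv h4

end Core

end Literature.RingTheory.HopfAlgebra
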